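import Summits.CriticalPhenomena.PercolationContinuityZ3.Theorems.PercNearOneGluingNoHeavyQuantFarBlockReach
import HarnessLib

/-!
# QUANT lane R8, front "FAR beyond trees", layer one — TWO-ANCHOR BLOCKS I: reachability inside a block whose relays hang at two anchors

builds on p205010 (kernel theorem, internal audit signed; external expert review pending)

Support file (`--supports stmt-CriticalPhenomena-4575`), seat `prim-quant-p1` (gen 19); memo
`run/shared/lean/prim/quant/prim-quant-p1-g19/FOR-LEAD-CACTI.md` §3 (kernel plan §5, file K5a).  Pure combinatorics of open paths (no measure);
standard axioms; no sorries.

**Setting.**  A block `Z` hangs at the cut vertex `c ∉ Z` (files `…QuantFarBlockReach/Law/Transfer`).  Inside the block a set `L ⊆ Z` of LEAVES,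
each leaf `ℓ` pendant at its parent `par ℓ ∈ {v₁, v₂} ⊆ Z ∖ L` (the two ANCHORS); the rest `Z ∖ L` is the CORE (arbitrary).  A configuration is
leaf-good (`Block.GoodL`) if every open pair at a leaf goes to its parent — almost surely so when the other pairs at the leaves carry weight `0`.

* `Block.core Z L ω` — the open pairs meeting `Z` and avoiding the leaves;
* `Block.inv_leaf_of_walk`, **`Block.on_reach_leaf_iff`**: for a leaf `ℓ`, `c ↔ ℓ on Z` iff (`c ↔ par ℓ` through the core) and `s(par ℓ, ℓ)` is open;
* **`Block.card_on_eq_twoAnchor`** — if the block relays are leaves, the block count splits as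
  `#{a ∈ A ∩ Z : c ↔ a on Z} = 𝟙[c ↔ v₁ in core]·#{ℓ ∈ A₁ : s(v₁,ℓ) open} + 𝟙[c ↔ v₂ in core]·#{ℓ ∈ A₂ : s(v₂,ℓ) open}`
  (`Aᵢ` = the block relays with parent `vᵢ`): the law-level `X = I₁Y₁ + I₂Y₂` of the memo §3.
[cite: Grimmett1999, §1.3 p. 10] (open paths); the bookkeeping is [this work].
-/

namespace Summit.CriticalPhenomena.PercolationContinuityZ3.Theorems

namespace Quant

namespace Block

open Finset
open Literature.Probability.Percolation
open scoped Classical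

variable {n : ℕ}

/-- The open pairs meeting the block `Z` and avoiding the leaf set `L` (the open CORE pairs). [this work] -/
def core (Z L : Finset (Fin n)) (ω : BondConfig (Fin n)) : BondConfig (Fin n) :=
  {e | e ∈ ω ∧ (∃ z ∈ Z, z ∈ e) ∧ ∀ ℓ ∈ L, ℓ ∉ e}

/-- `core Z L ω ⊆ onZ Z ω`. [this work] -/
theorem core_subset_onZ (Z L : Finset (Fin n)) (ω : BondConfig (Fin n)) : core Z L ω ⊆ onZ Z ω := fun _ he => ⟨he.1, he.2.1⟩

/-- Core paths are paths on `Z`. [this work] -/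
theorem on_reachable_of_core {Z L : Finset (Fin n)} {ω : BondConfig (Fin n)} {x y : Fin n}
    (h : (openGraph (core Z L ω)).Reachable x y) : (openGraph (onZ Z ω)).Reachable x y :=
  h.mono (SimpleGraph.fromEdgeSet_mono (core_subset_onZ Z L ω))

/-- A configuration is LEAF-GOOD if every open pair at a leaf `ℓ ∈ L` goes to its parent `par ℓ`. [this work] -/
def GoodL (L : Finset (Fin n)) (par : Fin n → Fin n) (ω : BondConfig (Fin n)) : Prop :=
  ∀ ℓ ∈ L, ∀ x : Fin n, x ≠ ℓ → s(ℓ, x) ∈ ω → x = par ℓ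

/-- The data of a two-anchor block: `c ∉ Z`, leaves `L ⊆ Z`, anchors `v₁ ≠ v₂` in `Z ∖ L`, every leaf's parent is an anchor. [this work] -/
structure IsTwoAnchor (c v₁ v₂ : Fin n) (Z L : Finset (Fin n)) (par : Fin n → Fin n) : Prop where
  cZ : c ∉ Z
  LZ : L ⊆ Z
  v₁Z : v₁ ∈ Z
  v₂Z : v₂ ∈ Z
  v₁L : v₁ ∉ L
  v₂L : v₂ ∉ L
  hne : v₁ ≠ v₂
  parv : ∀ ℓ ∈ L, par ℓ = v₁ ∨ par ℓ = v₂

section TwoAnchor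

variable {c v₁ v₂ : Fin n} {Z L : Finset (Fin n)} {par : Fin n → Fin n} (H : IsTwoAnchor c v₁ v₂ Z L par)
include H

/-- The parent of a leaf lies in the block and is not a leaf. [this work] -/
theorem par_mem {ℓ : Fin n} (hℓ : ℓ ∈ L) : par ℓ ∈ Z ∧ par ℓ ∉ L := by
  rcases H.parv ℓ hℓ with h | h <;> rw [h]
  · exact ⟨H.v₁Z, H.v₁L⟩
  · exact ⟨H.v₂Z, H.v₂L⟩

/-- A leaf differs from its parent. [this work] -/
theorem par_ne {ℓ : Fin n} (hℓ : ℓ ∈ L) : par ℓ ≠ ℓ := by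
  intro h
  have h2 := (par_mem H hℓ).2
  rw [h] at h2
  exact h2 hℓ

omit H in
/-- An open pair on `Z` between two non-leaves is a core edge. [this work] -/
theorem core_adj {ω : BondConfig (Fin n)} {x y : Fin n} (he : s(x, y) ∈ onZ Z ω) (hxy : x ≠ y) (hx : x ∉ L) (hy : y ∉ L) :
    (openGraph (core Z L ω)).Adj x y := by
  rw [openGraph_adj]
  refine ⟨⟨he.1, he.2, fun ℓ hℓ hmem => ?_⟩, hxy⟩
  rcases Sym2.mem_iff.1 hmem with rfl | rfl
  · exact hx hℓ
  · exact hy hℓ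

/-- Walk invariant at the leaves: along an open walk on `Z` ending at a non-leaf `y`, a non-leaf start is joined to `y` through the core, and
from a leaf start the parent is joined to `y` through the core and the leaf's pair to its parent is open. [this work] -/
theorem inv_leaf_of_walk {ω : BondConfig (Fin n)} (hω : GoodL L par ω) {y : Fin n} (hy : y ∉ L) :
    ∀ (u : Fin n) (_ : (openGraph (onZ Z ω)).Walk u y),
      (u ∉ L → (openGraph (core Z L ω)).Reachable u y) ∧
      (u ∈ L → (openGraph (core Z L ω)).Reachable (par u) y ∧ s(par u, u) ∈ ω) := by
  intro u q
  induction q with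
  | nil => exact ⟨fun _ => SimpleGraph.Reachable.refl _, fun h => absurd h hy⟩
  | cons hadj q' ih =>
    rename_i u' x y'
    obtain ⟨h1, h2⟩ := ih hy
    rw [openGraph_adj] at hadj
    obtain ⟨he, hne⟩ := hadj
    have heω : s(u', x) ∈ ω := he.1
    constructor
    · intro hu
      by_cases hxL : x ∈ L
      · -- the pair enters the leaf `x`, so `u' = par x`
        have hux : u' = par x := hω x hxL u' hne (by rw [Sym2.eq_swap]; exact heω)
        rw [hux]; exact (h2 hxL).1
      · exact (core_adj he hne hu hxL).reachable.trans (h1 hxL)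
    · intro hu
      have hxp : x = par u' := hω u' hu x (Ne.symm hne) heω
      have hxL : x ∉ L := by rw [hxp]; exact (par_mem H hu).2
      refine ⟨?_, ?_⟩
      · rw [← hxp]; exact h1 hxL
      · rw [← hxp, Sym2.eq_swap]; exact heω

/-- **Leaves are reached through their parent.**  For a leaf `ℓ ∈ L` of a leaf-good configuration: `c ↔ ℓ on Z` iff `c ↔ par ℓ` through the
core and `s(par ℓ, ℓ)` is open. [this work] -/
theorem on_reach_leaf_iff {ω : BondConfig (Fin n)} (hω : GoodL L par ω) {ℓ : Fin n} (hℓ : ℓ ∈ L) :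
    (openGraph (onZ Z ω)).Reachable c ℓ ↔ (openGraph (core Z L ω)).Reachable c (par ℓ) ∧ s(par ℓ, ℓ) ∈ ω := by
  have hcL : c ∉ L := fun h => H.cZ (H.LZ h)
  constructor
  · intro h
    obtain ⟨q⟩ := h.symm
    obtain ⟨hR, he⟩ := (inv_leaf_of_walk H hω hcL ℓ q).2 hℓ
    exact ⟨hR.symm, he⟩
  · rintro ⟨hR, he⟩
    have hadj : (openGraph (onZ Z ω)).Adj (par ℓ) ℓ := by
      rw [openGraph_adj]
      exact ⟨⟨he, ℓ, H.LZ hℓ, Sym2.mem_mk_right _ _⟩, par_ne H hℓ⟩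
    exact (on_reachable_of_core hR).trans hadj.reachable

/-- An anchor (indeed any non-leaf) is reached on `Z` iff it is reached through the core. [this work] -/
theorem on_reach_iff_core {ω : BondConfig (Fin n)} (hω : GoodL L par ω) {y : Fin n} (hy : y ∉ L) :
    (openGraph (onZ Z ω)).Reachable c y ↔ (openGraph (core Z L ω)).Reachable c y := by
  have hcL : c ∉ L := fun h => H.cZ (H.LZ h)
  refine ⟨fun h => ?_, on_reachable_of_core⟩
  obtain ⟨q⟩ := h
  exact (inv_leaf_of_walk H hω hy c q).1 hcL

/-- **The block count of a two-anchor block**: if the block relays are leaves (`A ∩ Z ⊆ L`), then on a leaf-good configuration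
`#{a ∈ A ∩ Z : c ↔ a on Z} = 𝟙[c ↔ v₁ in core]·#{ℓ ∈ A₁ : s(v₁,ℓ) ∈ ω} + 𝟙[c ↔ v₂ in core]·#{ℓ ∈ A₂ : s(v₂,ℓ) ∈ ω}` with
`Aᵢ = {a ∈ A ∩ Z : par a = vᵢ}`. [this work] -/
theorem card_on_eq_twoAnchor {ω : BondConfig (Fin n)} (hω : GoodL L par ω) {A : Finset (Fin n)} (hA : A ∩ Z ⊆ L) :
    ((A ∩ Z).filter fun a => onZ Z ω ∈ openConn c a).card =
      (if core Z L ω ∈ openConn c v₁ then (((A ∩ Z).filter fun a => par a = v₁).filter fun ℓ => s(v₁, ℓ) ∈ ω).card else 0) +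
      (if core Z L ω ∈ openConn c v₂ then (((A ∩ Z).filter fun a => par a = v₂).filter fun ℓ => s(v₂, ℓ) ∈ ω).card else 0) := by
  -- split `A ∩ Z` by parent
  have hsplit : ((A ∩ Z).filter fun a => onZ Z ω ∈ openConn c a) =
      (((A ∩ Z).filter fun a => par a = v₁).filter fun a => onZ Z ω ∈ openConn c a) ∪
      (((A ∩ Z).filter fun a => par a = v₂).filter fun a => onZ Z ω ∈ openConn c a) := by
    ext a
    simp only [mem_filter, mem_union]
    constructor
    · rintro ⟨ha, hr⟩
      rcases H.parv a (hA ha) with h | h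
      · exact Or.inl ⟨⟨ha, h⟩, hr⟩
      · exact Or.inr ⟨⟨ha, h⟩, hr⟩
    · rintro (⟨⟨ha, -⟩, hr⟩ | ⟨⟨ha, -⟩, hr⟩) <;> exact ⟨ha, hr⟩
  have hdisj : Disjoint (((A ∩ Z).filter fun a => par a = v₁).filter fun a => onZ Z ω ∈ openConn c a)
      (((A ∩ Z).filter fun a => par a = v₂).filter fun a => onZ Z ω ∈ openConn c a) := by
    rw [Finset.disjoint_left]
    intro a h1 h2
    have e1 := (mem_filter.1 (mem_filter.1 h1).1).2
    have e2 := (mem_filter.1 (mem_filter.1 h2).1).2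
    exact H.hne (e1.symm.trans e2)
  rw [hsplit, card_union_of_disjoint hdisj]
  -- each parent class
  have key : ∀ v : Fin n,
      (((A ∩ Z).filter fun a => par a = v).filter fun a => onZ Z ω ∈ openConn c a).card =
        (if core Z L ω ∈ openConn c v then (((A ∩ Z).filter fun a => par a = v).filter fun ℓ => s(v, ℓ) ∈ ω).card else 0) := by
    intro v
    by_cases hR : core Z L ω ∈ openConn c v
    · rw [if_pos hR]
      refine congrArg _ (filter_congr fun a ha => ?_)
      obtain ⟨haZ, hpa⟩ := mem_filter.1 ha
      rw [show (onZ Z ω ∈ openConn c a) = (openGraph (onZ Z ω)).Reachable c a from rfl,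
        on_reach_leaf_iff H hω (hA haZ), hpa]
      exact ⟨fun h => h.2, fun h => ⟨hR, h⟩⟩
    · rw [if_neg hR, card_eq_zero, filter_eq_empty_iff]
      intro a ha h
      obtain ⟨haZ, hpa⟩ := mem_filter.1 ha
      have := ((on_reach_leaf_iff H hω (hA haZ)).1 h).1
      rw [hpa] at this
      exact hR this
  rw [key v₁, key v₂]

end TwoAnchor

end Block

end Quant

end Summit.CriticalPhenomena.PercolationContinuityZ3.Theorems
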